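import Literature.NumberTheory.Automorphic.ConjugateSelfDualLocalValues
import Literature.NumberTheory.Automorphic.AdicCompletionUniformizerResidueCardGlue
import HarnessLib

/-!
# [Liu2021, Thm. D.6 (1)] bookkeeping: the split-place Hecke eigen-scalars of the two carriers, read in `valueAtUniformizer` currency

Topic `Literature/NumberTheory/Automorphic/Liu2021`; proof file (theorems only: no definition, no named fact, no instance, no
`sorry`); count-neutral.  Written for the d6 line of cell `hodgecm-mathlib` (card S4, «S4-readings»); HC_CM is NOT proved by
anything here.

The ★ local chain at a split place `w ∣ v` of a CM field `L` (`c` = complex conjugation) — ★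
`Liu2021.splitPlace_heckeOperator_localInt_apply_localSplittingCM_comp_localLineInl` (`SplitPlaceHeckeEigenvaluesAtLine`) read
through ★ `UnitaryGroup.heckeTAt_comp_finAdelicCongr_apply_eq_smul` — delivers, for the Weil carrier built on the splitting
attached to a unitary Hecke character `θ`, on every hyperspecial-fixed vector `x`, the two eigen-equations
`T_{w,1} x = (√q_w · (θ_w(ϖ_w) + χ′(ϖ_w) · θ_w(ϖ_w)⁻¹)) • x` and `T_{w,2} x = χ′(ϖ_w) • x`, the scalars spelled with
`Real.sqrt (residueFieldCard L_w)`, `θ.localComponent w (Units.mk0 ϖ _)` and a local character `χ′` (there `χ′ = χ̌_w`).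
The registered targets of the line ([Liu2021, Thm. D.6 (1)] l. 5436–5443 with `μ₁ := μ|·|^{-1/2}`, `μ₂ := μᶜχ̌|·|^{-1/2}`, proof
l. 5624) are spelled with `HeckeCharacter.valueAtUniformizer`, `Ideal.absNorm`, `IdeleClassGroup.muAlg` and `HeckeCharacter.galConj`.
This file is the dictionary between the two spellings, for BOTH carriers a consumer may hold, `μ` conjugate self-dual
(⇐ conjugate symplectic, [Liu2021, Rem. 4.2]):

* §0 glue: `Units.mk0 ↑ϖ_w _ = ϖ_w`, `θ_w(ϖ_w) = θ.valueAtUniformizer w` (`rfl`), `√(residueFieldCard L_w) = √N(w)`,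
  `(residueFieldCard L_w : ℂ) = N(w)`;
* §1 the hypothesis-free product `(μ^{alg})ᶜ(ϖ_w) · μ^{alg}(ϖ_w) = N(w)` (★ `valueAtUniformizer_galConj_muAlg_mul` asks
  `IsUnramifiedAt (c • w)`; via `(μᶜ)^{alg} = (μ^{alg})ᶜ` and `μᶜ = μ⁻¹` no ramification hypothesis is needed);
* §2 **case (A), carrier on `θ := toHeckeCharacter (galConj c μ)`**:
  `√q_w · (θ_w(ϖ_w) + x · θ_w(ϖ_w)⁻¹) = (μ^{alg})ᶜ(ϖ_w) + x · μ^{alg}(ϖ_w)`, so with `x = η(ϖ_w)`: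
  labels `((μ^{alg})ᶜ, μ^{alg} · η)`;
* §3 **case (B), carrier on `θ := toHeckeCharacter μ`**: `√q_w · (θ_w(ϖ_w) + x · θ_w(ϖ_w)⁻¹) = μ^{alg}(ϖ_w) + x · (μ^{alg})ᶜ(ϖ_w)`,
  labels `(μ^{alg}, (μ^{alg})ᶜ · η)` — the labels `μ₁, μ₂` of [Liu2021, Thm. D.6 (1)] as printed;
* §4 the same identities in the chain's literal spelling (`Real.sqrt (residueFieldCard L_w)`, `localComponent w (Units.mk0 ↑ϖ_w _)`);
* §5 the `•`-forms: from the chain's two equations to the target's `T₁ x = (b₁ + b₂) • x ∧ N(w) • T₂ x = (b₁ b₂) • x`, both cases.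

In both cases the product line is `N(w) · η(ϖ_w)`; the `T₁` lines of (A) and (B) differ by `√q_w (μ_w − μ_w⁻¹)(η(ϖ_w) − 1)`,
`μ_w := μ(ϖ_w)`.  Which case a consumer is in is decided by the splitting character its carrier was built on, nothing else.

## References
* Y. Liu, *Fourier–Jacobi cycles and arithmetic relative trace formula*, Camb. J. Math. 9 (2021): §4.1 (l. 1922, `μ|·|^{-1/2}`),
  Def. 4.1, Rem. 4.2, Rem. 4.4; App. D Thm. D.6 (1) (l. 5436–5443) and its proof (l. 5624); proof of Lem. D.1, first paragraph
  (l. 5241). [Liu2021]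
* J. Tate, *Fourier analysis in number fields and Hecke's zeta-functions* (1950/1967), §2.5, §4.3. [TateThesis1967]
* J. Neukirch, *Algebraic Number Theory* (1999), Ch. II §3, Prop. (4.3). [NeukirchANT1999]
-/

set_option autoImplicit false

noncomputable section

open NumberField IsDedekindDomain
open Literature.NumberTheory.GaloisRepresentations

/-! ## §0 Glue between the local and the global spellings -/

namespace Literature.NumberTheory.GaloisRepresentations.HeckeCharacter

variable (K : Type) [Field K] [NumberField K] (v : HeightOneSpectrum (𝓞 K))

/-- `Units.mk0 ↑ϖ_v _ = ϖ_v` for the chosen uniformiser unit `ϖ_v = HeckeCharacter.uniformizer K v` (the local eigenvalue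
theorems are stated at `Units.mk0 ϖ _` for a uniformising ELEMENT `ϖ`). [cite: NeukirchANT1999, Ch. II §3] -/
theorem mk0_coe_uniformizer (h : ((uniformizer K v : (v.adicCompletion K)ˣ) : v.adicCompletion K) ≠ 0) :
    Units.mk0 ((uniformizer K v : (v.adicCompletion K)ˣ) : v.adicCompletion K) h = uniformizer K v :=
  Units.mk0_val _ _

variable {K} in
/-- `χ_v(ϖ_v) = χ.valueAtUniformizer v` (definitional unfolding). [cite: TateThesis1967, §2.5] -/
theorem coe_localComponent_uniformizer (χ : HeckeCharacter K) :
    ((χ.localComponent v (uniformizer K v) : ℂˣ) : ℂ) = χ.valueAtUniformizer v :=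
  rfl

variable {K} in
/-- `χ_v(Units.mk0 ↑ϖ_v _) = χ.valueAtUniformizer v`. [cite: TateThesis1967, §2.5] -/
theorem coe_localComponent_mk0_coe_uniformizer (χ : HeckeCharacter K)
    (h : ((uniformizer K v : (v.adicCompletion K)ˣ) : v.adicCompletion K) ≠ 0) :
    ((χ.localComponent v (Units.mk0 ((uniformizer K v : (v.adicCompletion K)ˣ) : v.adicCompletion K) h) : ℂˣ) : ℂ) =
      χ.valueAtUniformizer v := by
  rw [mk0_coe_uniformizer K v h]
  rfl

/-- `√(residueFieldCard K_v) = √N(v)` (as complex numbers). [cite: NeukirchANT1999, Ch. II Prop. (4.3)] -/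
theorem sqrt_residueFieldCard_adicCompletion_eq :
    ((Real.sqrt (IsNonarchimedeanLocalField.residueFieldCard (v.adicCompletion K)) : ℝ) : ℂ) =
      ((Real.sqrt ((Ideal.absNorm v.asIdeal : ℕ) : ℝ) : ℝ) : ℂ) := by
  rw [Literature.NumberTheory.Automorphic.residueFieldCard_adicCompletion_eq_absNorm K v]

/-- `(residueFieldCard K_v : ℂ) = N(v)`. [cite: NeukirchANT1999, Ch. II Prop. (4.3)] -/
theorem natCast_residueFieldCard_adicCompletion_eq :
    ((IsNonarchimedeanLocalField.residueFieldCard (v.adicCompletion K) : ℕ) : ℂ) = (Ideal.absNorm v.asIdeal : ℂ) := by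
  rw [Literature.NumberTheory.Automorphic.residueFieldCard_adicCompletion_eq_absNorm K v]

/-- `√N(v) · √N(v) = N(v)` in `ℂ`. [cite: NeukirchANT1999, Ch. II Prop. (4.3)] -/
theorem sqrt_absNorm_mul_self :
    ((Real.sqrt ((Ideal.absNorm v.asIdeal : ℕ) : ℝ) : ℝ) : ℂ) * ((Real.sqrt ((Ideal.absNorm v.asIdeal : ℕ) : ℝ) : ℝ) : ℂ) =
      (Ideal.absNorm v.asIdeal : ℂ) := by
  rw [← Complex.ofReal_mul, Real.mul_self_sqrt (Nat.cast_nonneg _), Complex.ofReal_natCast]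

end Literature.NumberTheory.GaloisRepresentations.HeckeCharacter

namespace Literature.NumberTheory.Automorphic.IdeleClassGroup

variable {L : Type} [Field L] [NumberField L] [IsCMField L]

/-! ## §1 `(μ^{alg})ᶜ(ϖ_w) · μ^{alg}(ϖ_w) = N(w)` without ramification hypothesis -/

/-- **`√N(w) · μᶜ(ϖ_w) = (μ^{alg})ᶜ(ϖ_w)`** — for ANY unitary idele class character (no self-duality): `(μᶜ)^{alg} = (μ^{alg})ᶜ`
(★ `muAlg_galConj`, [Liu2021, Rem. 4.4]) and `μ^{alg}(ϖ) = μ(ϖ)√N` ([Liu2021, §4.1 l. 1922]).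
[cite: Liu2021, §4.1 (l. 1922); Remark 4.4 (ll. 1930–1933)] -/
theorem sqrt_absNorm_mul_valueAtUniformizer_toHeckeCharacter_galConj (ψ : IdeleClassGroup L →ₜ* Circle)
    (w : HeightOneSpectrum (𝓞 L)) :
    ((Real.sqrt ((Ideal.absNorm w.asIdeal : ℕ) : ℝ) : ℝ) : ℂ) *
        (toHeckeCharacter L (galConj (IsCMField.complexConj L) ψ)).valueAtUniformizer w =
      (HeckeCharacter.galConj (IsCMField.complexConj L) (muAlg L ψ)).valueAtUniformizer w := by
  rw [← muAlg_galConj, valueAtUniformizer_muAlg, mul_comm]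

omit [IsCMField L] in
/-- **`√N(w) · μ(ϖ_w) = μ^{alg}(ϖ_w)`** (★ `valueAtUniformizer_muAlg`, reoriented). [cite: Liu2021, §4.1 (l. 1922)] -/
theorem sqrt_absNorm_mul_valueAtUniformizer_toHeckeCharacter (ψ : IdeleClassGroup L →ₜ* Circle)
    (w : HeightOneSpectrum (𝓞 L)) :
    ((Real.sqrt ((Ideal.absNorm w.asIdeal : ℕ) : ℝ) : ℝ) : ℂ) * (toHeckeCharacter L ψ).valueAtUniformizer w =
      (muAlg L ψ).valueAtUniformizer w := by
  rw [valueAtUniformizer_muAlg, mul_comm]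

/-- **`√N(w) · μᶜ(ϖ_w)⁻¹ = μ^{alg}(ϖ_w)`** for `μ` conjugate self-dual (`μᶜ = μ⁻¹`, [Liu2021, Def. 4.1]).
[cite: Liu2021, Def. 4.1; §4.1 (l. 1922)] -/
theorem sqrt_absNorm_mul_valueAtUniformizer_toHeckeCharacter_galConj_inv {ψ : IdeleClassGroup L →ₜ* Circle}
    (h : IsConjugateSelfDual L ψ) (w : HeightOneSpectrum (𝓞 L)) :
    ((Real.sqrt ((Ideal.absNorm w.asIdeal : ℕ) : ℝ) : ℝ) : ℂ) *
        ((toHeckeCharacter L (galConj (IsCMField.complexConj L) ψ)).valueAtUniformizer w)⁻¹ =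
      (muAlg L ψ).valueAtUniformizer w := by
  rw [valueAtUniformizer_toHeckeCharacter_galConj_complexConj h w, inv_inv,
    sqrt_absNorm_mul_valueAtUniformizer_toHeckeCharacter]

/-- **`√N(w) · μ(ϖ_w)⁻¹ = (μ^{alg})ᶜ(ϖ_w)`** for `μ` conjugate self-dual. [cite: Liu2021, Def. 4.1; §4.1 (l. 1922); Remark 4.4] -/
theorem sqrt_absNorm_mul_valueAtUniformizer_toHeckeCharacter_inv {ψ : IdeleClassGroup L →ₜ* Circle}
    (h : IsConjugateSelfDual L ψ) (w : HeightOneSpectrum (𝓞 L)) :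
    ((Real.sqrt ((Ideal.absNorm w.asIdeal : ℕ) : ℝ) : ℝ) : ℂ) * ((toHeckeCharacter L ψ).valueAtUniformizer w)⁻¹ =
      (HeckeCharacter.galConj (IsCMField.complexConj L) (muAlg L ψ)).valueAtUniformizer w := by
  rw [← valueAtUniformizer_toHeckeCharacter_galConj_complexConj h w,
    sqrt_absNorm_mul_valueAtUniformizer_toHeckeCharacter_galConj]

/-- **`(μ^{alg})ᶜ(ϖ_w) · μ^{alg}(ϖ_w) = N(w)`** for `μ` conjugate self-dual, at EVERY finite place `w` — no ramification hypothesis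
(compare ★ `valueAtUniformizer_galConj_muAlg_mul`, which asks `IsUnramifiedAt (c • w)` because it reads `(μ^{alg})ᶜ(ϖ_w)` as
`μ^{alg}(ϖ_{c•w})`; here `(μ^{alg})ᶜ = (μᶜ)^{alg}` and `μᶜ = μ⁻¹` are identities of Hecke characters).
[cite: Liu2021, Def. 4.1; §4.1 (l. 1922); Remark 4.4 (ll. 1930–1933)] -/
theorem valueAtUniformizer_galConj_muAlg_mul_muAlg {ψ : IdeleClassGroup L →ₜ* Circle} (h : IsConjugateSelfDual L ψ)
    (w : HeightOneSpectrum (𝓞 L)) :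
    (HeckeCharacter.galConj (IsCMField.complexConj L) (muAlg L ψ)).valueAtUniformizer w * (muAlg L ψ).valueAtUniformizer w =
      (Ideal.absNorm w.asIdeal : ℂ) := by
  have hne : (toHeckeCharacter L ψ).valueAtUniformizer w ≠ 0 := valueAtUniformizer_toHeckeCharacter_ne_zero ψ w
  rw [← sqrt_absNorm_mul_valueAtUniformizer_toHeckeCharacter_inv h w,
    ← sqrt_absNorm_mul_valueAtUniformizer_toHeckeCharacter ψ w, ← HeckeCharacter.sqrt_absNorm_mul_self L w]
  field_simp

/-- the conjugate-symplectic case. [cite: Liu2021, Remark 4.2; §4.1 (l. 1922)] -/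
theorem IsConjugateSymplectic.valueAtUniformizer_galConj_muAlg_mul_muAlg {ψ : IdeleClassGroup L →ₜ* Circle}
    (h : IsConjugateSymplectic L ψ) (w : HeightOneSpectrum (𝓞 L)) :
    (HeckeCharacter.galConj (IsCMField.complexConj L) (muAlg L ψ)).valueAtUniformizer w * (muAlg L ψ).valueAtUniformizer w =
      (Ideal.absNorm w.asIdeal : ℂ) :=
  IdeleClassGroup.valueAtUniformizer_galConj_muAlg_mul_muAlg h.isConjugateSelfDual w

/-! ## §2 Case (A): the carrier on `θ := toHeckeCharacter (galConj c μ)` — labels `((μ^{alg})ᶜ, μ^{alg}·η)` -/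

/-- **Case (A), `T₁` line**: for `μ` conjugate self-dual and `θ := μᶜ` (as a Hecke character), for every `x : ℂ`,
`√N(w) · (θ(ϖ_w) + x · θ(ϖ_w)⁻¹) = (μ^{alg})ᶜ(ϖ_w) + x · μ^{alg}(ϖ_w)`.
[cite: Liu2021, Def. 4.1; §4.1 (l. 1922); Remark 4.4; Thm. D.6 (1) proof (l. 5624)] -/
theorem sqrt_absNorm_mul_galConj_add {ψ : IdeleClassGroup L →ₜ* Circle} (h : IsConjugateSelfDual L ψ)
    (w : HeightOneSpectrum (𝓞 L)) (x : ℂ) :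
    ((Real.sqrt ((Ideal.absNorm w.asIdeal : ℕ) : ℝ) : ℝ) : ℂ) *
        ((toHeckeCharacter L (galConj (IsCMField.complexConj L) ψ)).valueAtUniformizer w +
          x * ((toHeckeCharacter L (galConj (IsCMField.complexConj L) ψ)).valueAtUniformizer w)⁻¹) =
      (HeckeCharacter.galConj (IsCMField.complexConj L) (muAlg L ψ)).valueAtUniformizer w +
        x * (muAlg L ψ).valueAtUniformizer w := by
  rw [mul_add, mul_left_comm, sqrt_absNorm_mul_valueAtUniformizer_toHeckeCharacter_galConj,
    sqrt_absNorm_mul_valueAtUniformizer_toHeckeCharacter_galConj_inv h]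

/-- **Case (A), `T₁` line at `x = η(ϖ_w)`**: `√N(w) · (θ(ϖ_w) + η(ϖ_w) θ(ϖ_w)⁻¹) = (μ^{alg})ᶜ(ϖ_w) + (μ^{alg}·η)(ϖ_w)`
(`θ = μᶜ`; in the d6 line `η = χ̌`). [cite: Liu2021, Thm. D.6 (1) (l. 5436–5443) and proof (l. 5624); Def. 4.1] -/
theorem sqrt_absNorm_mul_galConj_add_eq_labels {ψ : IdeleClassGroup L →ₜ* Circle} (h : IsConjugateSelfDual L ψ)
    (η : HeckeCharacter L) (w : HeightOneSpectrum (𝓞 L)) :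
    ((Real.sqrt ((Ideal.absNorm w.asIdeal : ℕ) : ℝ) : ℝ) : ℂ) *
        ((toHeckeCharacter L (galConj (IsCMField.complexConj L) ψ)).valueAtUniformizer w +
          η.valueAtUniformizer w * ((toHeckeCharacter L (galConj (IsCMField.complexConj L) ψ)).valueAtUniformizer w)⁻¹) =
      (HeckeCharacter.galConj (IsCMField.complexConj L) (muAlg L ψ)).valueAtUniformizer w +
        (muAlg L ψ * η).valueAtUniformizer w := by
  rw [sqrt_absNorm_mul_galConj_add h, HeckeCharacter.valueAtUniformizer_mul', mul_comm (η.valueAtUniformizer w)]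

/-- **Case (A), product line**: `N(w) · η(ϖ_w) = (μ^{alg})ᶜ(ϖ_w) · (μ^{alg}·η)(ϖ_w)`.
[cite: Liu2021, Thm. D.6 (1) (l. 5436–5443) and proof (l. 5624); §4.1 (l. 1922)] -/
theorem absNorm_mul_eq_galConj_mul_labels {ψ : IdeleClassGroup L →ₜ* Circle} (h : IsConjugateSelfDual L ψ)
    (η : HeckeCharacter L) (w : HeightOneSpectrum (𝓞 L)) :
    (Ideal.absNorm w.asIdeal : ℂ) * η.valueAtUniformizer w =
      (HeckeCharacter.galConj (IsCMField.complexConj L) (muAlg L ψ)).valueAtUniformizer w *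
        (muAlg L ψ * η).valueAtUniformizer w := by
  rw [HeckeCharacter.valueAtUniformizer_mul', ← valueAtUniformizer_galConj_muAlg_mul_muAlg h w]
  ring

/-! ## §3 Case (B): the carrier on `θ := toHeckeCharacter μ` — labels `(μ^{alg}, (μ^{alg})ᶜ·η)` (print's `μ₁, μ₂`) -/

/-- **Case (B), `T₁` line**: for `μ` conjugate self-dual and `θ := μ`, for every `x : ℂ`,
`√N(w) · (θ(ϖ_w) + x · θ(ϖ_w)⁻¹) = μ^{alg}(ϖ_w) + x · (μ^{alg})ᶜ(ϖ_w)`.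
[cite: Liu2021, Def. 4.1; §4.1 (l. 1922); Thm. D.6 (1) proof (l. 5624)] -/
theorem sqrt_absNorm_mul_add {ψ : IdeleClassGroup L →ₜ* Circle} (h : IsConjugateSelfDual L ψ)
    (w : HeightOneSpectrum (𝓞 L)) (x : ℂ) :
    ((Real.sqrt ((Ideal.absNorm w.asIdeal : ℕ) : ℝ) : ℝ) : ℂ) *
        ((toHeckeCharacter L ψ).valueAtUniformizer w + x * ((toHeckeCharacter L ψ).valueAtUniformizer w)⁻¹) =
      (muAlg L ψ).valueAtUniformizer w +
        x * (HeckeCharacter.galConj (IsCMField.complexConj L) (muAlg L ψ)).valueAtUniformizer w := by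
  rw [mul_add, mul_left_comm, sqrt_absNorm_mul_valueAtUniformizer_toHeckeCharacter,
    sqrt_absNorm_mul_valueAtUniformizer_toHeckeCharacter_inv h]

/-- **Case (B), `T₁` line at `x = η(ϖ_w)`**: `√N(w) · (θ(ϖ_w) + η(ϖ_w) θ(ϖ_w)⁻¹) = μ^{alg}(ϖ_w) + ((μ^{alg})ᶜ·η)(ϖ_w)` —
the printed `μ₁(ϖ_w) + μ₂(ϖ_w)` of [Liu2021, Thm. D.6 (1)] (`μ₁ = μ|·|^{-1/2}`, `μ₂ = μᶜχ̌|·|^{-1/2}`, l. 5624) at `η = χ̌`.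
[cite: Liu2021, Thm. D.6 (1) (l. 5436–5443) and proof (l. 5624); Def. 4.1] -/
theorem sqrt_absNorm_mul_add_eq_labels {ψ : IdeleClassGroup L →ₜ* Circle} (h : IsConjugateSelfDual L ψ)
    (η : HeckeCharacter L) (w : HeightOneSpectrum (𝓞 L)) :
    ((Real.sqrt ((Ideal.absNorm w.asIdeal : ℕ) : ℝ) : ℝ) : ℂ) *
        ((toHeckeCharacter L ψ).valueAtUniformizer w +
          η.valueAtUniformizer w * ((toHeckeCharacter L ψ).valueAtUniformizer w)⁻¹) =
      (muAlg L ψ).valueAtUniformizer w +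
        (HeckeCharacter.galConj (IsCMField.complexConj L) (muAlg L ψ) * η).valueAtUniformizer w := by
  rw [sqrt_absNorm_mul_add h, HeckeCharacter.valueAtUniformizer_mul', mul_comm (η.valueAtUniformizer w)]

/-- **Case (B), product line**: `N(w) · η(ϖ_w) = μ^{alg}(ϖ_w) · ((μ^{alg})ᶜ·η)(ϖ_w)` (print's `μ₁(ϖ_w) μ₂(ϖ_w)` at `η = χ̌`).
[cite: Liu2021, Thm. D.6 (1) (l. 5436–5443) and proof (l. 5624); §4.1 (l. 1922)] -/
theorem absNorm_mul_eq_mul_galConj_labels {ψ : IdeleClassGroup L →ₜ* Circle} (h : IsConjugateSelfDual L ψ)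
    (η : HeckeCharacter L) (w : HeightOneSpectrum (𝓞 L)) :
    (Ideal.absNorm w.asIdeal : ℂ) * η.valueAtUniformizer w =
      (muAlg L ψ).valueAtUniformizer w *
        (HeckeCharacter.galConj (IsCMField.complexConj L) (muAlg L ψ) * η).valueAtUniformizer w := by
  rw [HeckeCharacter.valueAtUniformizer_mul', ← valueAtUniformizer_galConj_muAlg_mul_muAlg h w]
  ring

/-- the two `T₁` readings differ by `√N(w) · (μ(ϖ_w) − μ(ϖ_w)⁻¹) · (x − 1)` — case (A) minus case (B); they agree only where
`μ(ϖ_w)² = 1` or `x = 1`. [cite: Liu2021, Thm. D.6 (1) (l. 5436–5443); Def. 4.1] -/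
theorem galConj_labels_sub_labels {ψ : IdeleClassGroup L →ₜ* Circle} (h : IsConjugateSelfDual L ψ)
    (w : HeightOneSpectrum (𝓞 L)) (x : ℂ) :
    ((HeckeCharacter.galConj (IsCMField.complexConj L) (muAlg L ψ)).valueAtUniformizer w +
        x * (muAlg L ψ).valueAtUniformizer w) -
      ((muAlg L ψ).valueAtUniformizer w +
        x * (HeckeCharacter.galConj (IsCMField.complexConj L) (muAlg L ψ)).valueAtUniformizer w) =
      ((Real.sqrt ((Ideal.absNorm w.asIdeal : ℕ) : ℝ) : ℝ) : ℂ) *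
        ((toHeckeCharacter L ψ).valueAtUniformizer w - ((toHeckeCharacter L ψ).valueAtUniformizer w)⁻¹) * (x - 1) := by
  rw [← sqrt_absNorm_mul_valueAtUniformizer_toHeckeCharacter ψ w,
    ← sqrt_absNorm_mul_valueAtUniformizer_toHeckeCharacter_inv h w]
  ring

/-! ## §4 The same readings in the chain's literal spelling -/

/-- **Case (A) in the local spelling, `T₁`**: with `θ := toHeckeCharacter (galConj c μ)`, `ϖ_w` the chosen uniformiser unit and
`η` any Hecke character (read at `w` through `localComponent`),
`√(residueFieldCard L_w) · (θ_w(mk0 ϖ_w) + η_w(mk0 ϖ_w) · θ_w(mk0 ϖ_w)⁻¹) = (μ^{alg})ᶜ(ϖ_w) + (μ^{alg}·η)(ϖ_w)`.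
[cite: Liu2021, Thm. D.6 (1) (l. 5436–5443) and proof (l. 5624); proof of Lemma D.1, first paragraph (l. 5241)] -/
theorem sqrt_residueFieldCard_mul_localComponent_galConj_add_eq_labels {ψ : IdeleClassGroup L →ₜ* Circle}
    (h : IsConjugateSelfDual L ψ) (η : HeckeCharacter L) (w : HeightOneSpectrum (𝓞 L))
    (h0 : ((HeckeCharacter.uniformizer L w : (w.adicCompletion L)ˣ) : w.adicCompletion L) ≠ 0) :
    ((Real.sqrt (IsNonarchimedeanLocalField.residueFieldCard (w.adicCompletion L)) : ℝ) : ℂ) *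
        ((((toHeckeCharacter L (galConj (IsCMField.complexConj L) ψ)).localComponent w
              (Units.mk0 ((HeckeCharacter.uniformizer L w : (w.adicCompletion L)ˣ) : w.adicCompletion L) h0) : ℂˣ) : ℂ) +
          ((η.localComponent w
              (Units.mk0 ((HeckeCharacter.uniformizer L w : (w.adicCompletion L)ˣ) : w.adicCompletion L) h0) : ℂˣ) : ℂ) *
            ((((toHeckeCharacter L (galConj (IsCMField.complexConj L) ψ)).localComponent w
              (Units.mk0 ((HeckeCharacter.uniformizer L w : (w.adicCompletion L)ˣ) : w.adicCompletion L) h0) : ℂˣ) : ℂ))⁻¹) =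
      (HeckeCharacter.galConj (IsCMField.complexConj L) (muAlg L ψ)).valueAtUniformizer w +
        (muAlg L ψ * η).valueAtUniformizer w := by
  rw [HeckeCharacter.mk0_coe_uniformizer L w h0, HeckeCharacter.sqrt_residueFieldCard_adicCompletion_eq L w]
  exact sqrt_absNorm_mul_galConj_add_eq_labels h η w

/-- **Case (A) in the local spelling, `T₂`**: `N(w) · η_w(mk0 ϖ_w) = (μ^{alg})ᶜ(ϖ_w) · (μ^{alg}·η)(ϖ_w)`.
[cite: Liu2021, Thm. D.6 (1) (l. 5436–5443) and proof (l. 5624)] -/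
theorem absNorm_mul_localComponent_eq_galConj_mul_labels {ψ : IdeleClassGroup L →ₜ* Circle}
    (h : IsConjugateSelfDual L ψ) (η : HeckeCharacter L) (w : HeightOneSpectrum (𝓞 L))
    (h0 : ((HeckeCharacter.uniformizer L w : (w.adicCompletion L)ˣ) : w.adicCompletion L) ≠ 0) :
    (Ideal.absNorm w.asIdeal : ℂ) *
        ((η.localComponent w
            (Units.mk0 ((HeckeCharacter.uniformizer L w : (w.adicCompletion L)ˣ) : w.adicCompletion L) h0) : ℂˣ) : ℂ) =
      (HeckeCharacter.galConj (IsCMField.complexConj L) (muAlg L ψ)).valueAtUniformizer w *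
        (muAlg L ψ * η).valueAtUniformizer w := by
  rw [HeckeCharacter.mk0_coe_uniformizer L w h0]
  exact absNorm_mul_eq_galConj_mul_labels h η w

/-- **Case (B) in the local spelling, `T₁`**: with `θ := toHeckeCharacter μ`,
`√(residueFieldCard L_w) · (θ_w(mk0 ϖ_w) + η_w(mk0 ϖ_w) · θ_w(mk0 ϖ_w)⁻¹) = μ^{alg}(ϖ_w) + ((μ^{alg})ᶜ·η)(ϖ_w)`.
[cite: Liu2021, Thm. D.6 (1) (l. 5436–5443) and proof (l. 5624); proof of Lemma D.1, first paragraph (l. 5241)] -/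
theorem sqrt_residueFieldCard_mul_localComponent_add_eq_labels {ψ : IdeleClassGroup L →ₜ* Circle}
    (h : IsConjugateSelfDual L ψ) (η : HeckeCharacter L) (w : HeightOneSpectrum (𝓞 L))
    (h0 : ((HeckeCharacter.uniformizer L w : (w.adicCompletion L)ˣ) : w.adicCompletion L) ≠ 0) :
    ((Real.sqrt (IsNonarchimedeanLocalField.residueFieldCard (w.adicCompletion L)) : ℝ) : ℂ) *
        ((((toHeckeCharacter L ψ).localComponent w
              (Units.mk0 ((HeckeCharacter.uniformizer L w : (w.adicCompletion L)ˣ) : w.adicCompletion L) h0) : ℂˣ) : ℂ) +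
          ((η.localComponent w
              (Units.mk0 ((HeckeCharacter.uniformizer L w : (w.adicCompletion L)ˣ) : w.adicCompletion L) h0) : ℂˣ) : ℂ) *
            ((((toHeckeCharacter L ψ).localComponent w
              (Units.mk0 ((HeckeCharacter.uniformizer L w : (w.adicCompletion L)ˣ) : w.adicCompletion L) h0) : ℂˣ) : ℂ))⁻¹) =
      (muAlg L ψ).valueAtUniformizer w +
        (HeckeCharacter.galConj (IsCMField.complexConj L) (muAlg L ψ) * η).valueAtUniformizer w := by
  rw [HeckeCharacter.mk0_coe_uniformizer L w h0, HeckeCharacter.sqrt_residueFieldCard_adicCompletion_eq L w]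
  exact sqrt_absNorm_mul_add_eq_labels h η w

/-- **Case (B) in the local spelling, `T₂`**: `N(w) · η_w(mk0 ϖ_w) = μ^{alg}(ϖ_w) · ((μ^{alg})ᶜ·η)(ϖ_w)`.
[cite: Liu2021, Thm. D.6 (1) (l. 5436–5443) and proof (l. 5624)] -/
theorem absNorm_mul_localComponent_eq_mul_galConj_labels {ψ : IdeleClassGroup L →ₜ* Circle}
    (h : IsConjugateSelfDual L ψ) (η : HeckeCharacter L) (w : HeightOneSpectrum (𝓞 L))
    (h0 : ((HeckeCharacter.uniformizer L w : (w.adicCompletion L)ˣ) : w.adicCompletion L) ≠ 0) :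
    (Ideal.absNorm w.asIdeal : ℂ) *
        ((η.localComponent w
            (Units.mk0 ((HeckeCharacter.uniformizer L w : (w.adicCompletion L)ˣ) : w.adicCompletion L) h0) : ℂˣ) : ℂ) =
      (muAlg L ψ).valueAtUniformizer w *
        (HeckeCharacter.galConj (IsCMField.complexConj L) (muAlg L ψ) * η).valueAtUniformizer w := by
  rw [HeckeCharacter.mk0_coe_uniformizer L w h0]
  exact absNorm_mul_eq_mul_galConj_labels h η w

/-! ## §5 The `•`-forms: from the chain's two local equations to the target's pair of eigen-equations -/

section SMul

variable {V : Type*} [AddCommGroup V] [Module ℂ V]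

/-- **Case (A), eigen-equations.**  If `T₁x = (√(residueFieldCard L_w)·(θ_w(mk0 ϖ_w) + η_w(mk0 ϖ_w) θ_w(mk0 ϖ_w)⁻¹)) • x` and
`T₂x = η_w(mk0 ϖ_w) • x` with `θ := toHeckeCharacter (galConj c μ)` (the shape delivered by the d6 chain for the carrier on `μᶜ`),
then `T₁x = ((μ^{alg})ᶜ(ϖ_w) + (μ^{alg}·η)(ϖ_w)) • x` and `N(w) • T₂x = ((μ^{alg})ᶜ(ϖ_w) · (μ^{alg}·η)(ϖ_w)) • x`.
[cite: Liu2021, Thm. D.6 (1) (l. 5436–5443) and proof (l. 5624); proof of Lemma D.1, first paragraph (l. 5241)] -/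
theorem eigen_eq_galConj_labels_of_chain {ψ : IdeleClassGroup L →ₜ* Circle} (h : IsConjugateSelfDual L ψ)
    (η : HeckeCharacter L) (w : HeightOneSpectrum (𝓞 L))
    (h0 : ((HeckeCharacter.uniformizer L w : (w.adicCompletion L)ˣ) : w.adicCompletion L) ≠ 0)
    {T₁x T₂x x : V}
    (h₁ : T₁x = (((Real.sqrt (IsNonarchimedeanLocalField.residueFieldCard (w.adicCompletion L)) : ℝ) : ℂ) *
        ((((toHeckeCharacter L (galConj (IsCMField.complexConj L) ψ)).localComponent w
              (Units.mk0 ((HeckeCharacter.uniformizer L w : (w.adicCompletion L)ˣ) : w.adicCompletion L) h0) : ℂˣ) : ℂ) +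
          ((η.localComponent w
              (Units.mk0 ((HeckeCharacter.uniformizer L w : (w.adicCompletion L)ˣ) : w.adicCompletion L) h0) : ℂˣ) : ℂ) *
            ((((toHeckeCharacter L (galConj (IsCMField.complexConj L) ψ)).localComponent w
              (Units.mk0 ((HeckeCharacter.uniformizer L w : (w.adicCompletion L)ˣ) : w.adicCompletion L) h0) : ℂˣ) : ℂ))⁻¹)) • x)
    (h₂ : T₂x = ((η.localComponent w
        (Units.mk0 ((HeckeCharacter.uniformizer L w : (w.adicCompletion L)ˣ) : w.adicCompletion L) h0) : ℂˣ) : ℂ) • x) :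
    T₁x = ((HeckeCharacter.galConj (IsCMField.complexConj L) (muAlg L ψ)).valueAtUniformizer w +
        (muAlg L ψ * η).valueAtUniformizer w) • x ∧
      (Ideal.absNorm w.asIdeal : ℂ) • T₂x =
        ((HeckeCharacter.galConj (IsCMField.complexConj L) (muAlg L ψ)).valueAtUniformizer w *
          (muAlg L ψ * η).valueAtUniformizer w) • x := by
  refine ⟨?_, ?_⟩
  · rw [h₁, sqrt_residueFieldCard_mul_localComponent_galConj_add_eq_labels h η w h0]
  · rw [h₂, smul_smul, absNorm_mul_localComponent_eq_galConj_mul_labels h η w h0]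

/-- **Case (B), eigen-equations.**  The same with `θ := toHeckeCharacter μ`: conclusions with the printed labels
`(μ^{alg}, (μ^{alg})ᶜ·η)`. [cite: Liu2021, Thm. D.6 (1) (l. 5436–5443) and proof (l. 5624); proof of Lemma D.1, first paragraph (l. 5241)] -/
theorem eigen_eq_labels_of_chain {ψ : IdeleClassGroup L →ₜ* Circle} (h : IsConjugateSelfDual L ψ)
    (η : HeckeCharacter L) (w : HeightOneSpectrum (𝓞 L))
    (h0 : ((HeckeCharacter.uniformizer L w : (w.adicCompletion L)ˣ) : w.adicCompletion L) ≠ 0)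
    {T₁x T₂x x : V}
    (h₁ : T₁x = (((Real.sqrt (IsNonarchimedeanLocalField.residueFieldCard (w.adicCompletion L)) : ℝ) : ℂ) *
        ((((toHeckeCharacter L ψ).localComponent w
              (Units.mk0 ((HeckeCharacter.uniformizer L w : (w.adicCompletion L)ˣ) : w.adicCompletion L) h0) : ℂˣ) : ℂ) +
          ((η.localComponent w
              (Units.mk0 ((HeckeCharacter.uniformizer L w : (w.adicCompletion L)ˣ) : w.adicCompletion L) h0) : ℂˣ) : ℂ) *
            ((((toHeckeCharacter L ψ).localComponent w
              (Units.mk0 ((HeckeCharacter.uniformizer L w : (w.adicCompletion L)ˣ) : w.adicCompletion L) h0) : ℂˣ) : ℂ))⁻¹)) • x)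
    (h₂ : T₂x = ((η.localComponent w
        (Units.mk0 ((HeckeCharacter.uniformizer L w : (w.adicCompletion L)ˣ) : w.adicCompletion L) h0) : ℂˣ) : ℂ) • x) :
    T₁x = ((muAlg L ψ).valueAtUniformizer w +
        (HeckeCharacter.galConj (IsCMField.complexConj L) (muAlg L ψ) * η).valueAtUniformizer w) • x ∧
      (Ideal.absNorm w.asIdeal : ℂ) • T₂x =
        ((muAlg L ψ).valueAtUniformizer w *
          (HeckeCharacter.galConj (IsCMField.complexConj L) (muAlg L ψ) * η).valueAtUniformizer w) • x := by
  refine ⟨?_, ?_⟩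
  · rw [h₁, sqrt_residueFieldCard_mul_localComponent_add_eq_labels h η w h0]
  · rw [h₂, smul_smul, absNorm_mul_localComponent_eq_mul_galConj_labels h η w h0]

/-- **Conjugate-symplectic entry point, case (A)** (the d6 line's `hμ`; case (B): `eigen_eq_labels_of_chain h.isConjugateSelfDual`).
[cite: Liu2021, Remark 4.2; Thm. D.6 (1) (l. 5436–5443)] -/
theorem IsConjugateSymplectic.eigen_eq_galConj_labels_of_chain {ψ : IdeleClassGroup L →ₜ* Circle}
    (h : IsConjugateSymplectic L ψ) (η : HeckeCharacter L) (w : HeightOneSpectrum (𝓞 L))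
    (h0 : ((HeckeCharacter.uniformizer L w : (w.adicCompletion L)ˣ) : w.adicCompletion L) ≠ 0)
    {T₁x T₂x x : V}
    (h₁ : T₁x = (((Real.sqrt (IsNonarchimedeanLocalField.residueFieldCard (w.adicCompletion L)) : ℝ) : ℂ) *
        ((((toHeckeCharacter L (IdeleClassGroup.galConj (IsCMField.complexConj L) ψ)).localComponent w
              (Units.mk0 ((HeckeCharacter.uniformizer L w : (w.adicCompletion L)ˣ) : w.adicCompletion L) h0) : ℂˣ) : ℂ) +
          ((η.localComponent w
              (Units.mk0 ((HeckeCharacter.uniformizer L w : (w.adicCompletion L)ˣ) : w.adicCompletion L) h0) : ℂˣ) : ℂ) *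
            ((((toHeckeCharacter L (IdeleClassGroup.galConj (IsCMField.complexConj L) ψ)).localComponent w
              (Units.mk0 ((HeckeCharacter.uniformizer L w : (w.adicCompletion L)ˣ) : w.adicCompletion L) h0) : ℂˣ) : ℂ))⁻¹)) • x)
    (h₂ : T₂x = ((η.localComponent w
        (Units.mk0 ((HeckeCharacter.uniformizer L w : (w.adicCompletion L)ˣ) : w.adicCompletion L) h0) : ℂˣ) : ℂ) • x) :
    T₁x = ((HeckeCharacter.galConj (IsCMField.complexConj L) (muAlg L ψ)).valueAtUniformizer w +
        (muAlg L ψ * η).valueAtUniformizer w) • x ∧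
      (Ideal.absNorm w.asIdeal : ℂ) • T₂x =
        ((HeckeCharacter.galConj (IsCMField.complexConj L) (muAlg L ψ)).valueAtUniformizer w *
          (muAlg L ψ * η).valueAtUniformizer w) • x :=
  IdeleClassGroup.eigen_eq_galConj_labels_of_chain h.isConjugateSelfDual η w h0 h₁ h₂

end SMul

end Literature.NumberTheory.Automorphic.IdeleClassGroup

end
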